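/-
Copyright (c) 2026 the pub-hodgecm-mathlib formalisation cell (harness21).  Prover seat hodgecm-mathlib-LH5-p02 (g3): line LH3 (closer stub `stub_N9`, organ J),
sliver (b2) «`hTAβ` + `Ψβ`∕`hΨβ`» (LH3-plan (g3) DEALER BOARD v3.6, 2026-09-02T08:57:15Z).
-/
import Literature.NumberTheory.Automorphic.ArchInnerFormSemiregularCentralizerBlockCayley   -- ★ p850544 ([5β], `gprimeTorus_insert_mem_centralizer`); [7β] = ★ p850682 enters as a HYPOTHESIS text
import Literature.NumberTheory.Automorphic.ArchInnerFormSemiregularCentralizerQuotient           -- ★ p850477: `exists_quotient_homeomorph_of_map_eq_prod_top`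
import Literature.NumberTheory.Automorphic.ArchSharedRankOneDatum                                 -- ★ `exists_hypBlockGL_eq_of_mem_torusU` (+ `hypBlockGL_mem_torusU`, `torusU`)
import Literature.NumberTheory.Automorphic.ArchRankOneBlockStandardiseCayley                        -- ★ p850661 (B-STD) (iii): `std_eq_hypBlockGL_of_coe_eq_boost`
import HarnessLib

/-!
# The split chart torus in the STANDARD rank-one group: `g ∈ T_{insert w₀ S′} ↔ (e′ g).1 ∈ torusU`, and `M′ ⧸ T_{insert w₀ S′} ≃ₜ U(J) ⧸ torusU`
# (sliver (b2) of the (G′-CANCEL) head; Rogawski 1990 §3.6, §8.2 p. 122; Shelstad 1979 §4)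

Topic `NumberTheory/Automorphic`; namespace `Literature.NumberTheory.Automorphic.UnitaryGroup`.  THEOREMS ONLY (no `def`, no instance, no notation, no axiom, no named fact,
no `sorry`).  Cell `pub/hodgecm-mathlib`, crux H413 (`stmt-HodgeConjecture-24833`), F0∕P3c line LH3 (closer stub `stub_N9`, organ J).  The (G′-CANCEL) head
★ `Rogawski1990.ArchChartOrbGBlockDescents` (LH3-p03 (g4), p850534) reads the Cayley chart through the STANDARDISED block decomposition
`e′ = (φ × id) ∘ e : M′ ≃ₜ* U(J) × K` (`φ : B ≃ₜ* U(J)` = (B-STD), ★ `ArchRankOneBlockStandardise`, RULINGS #9) via three binders: `hTAβ : g ∈ T♯ ↔ (e′ g).1 ∈ torusU`,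
`Ψβ : M′ ⧸ T♯ ≃ₜ U(J) ⧸ torusU`, `hΨβ : Ψβ⁻¹ ⟦u⟧ = ⟦e′⁻¹ (u, 1)⟧`.  This file DISCHARGES them in BINDER form from ★ [7β] (p850682: `g ∈ T♯ ↔ (e g).1` is a boost
block), ★ [5β] (p850544: every boost block occurs), ★ (B-STD) (iii) (p850661: `φ(boost block c) = hypBlockGL (c 0) (c 2)`, a hypothesis here) and the torus parametrisation
★ `exists_hypBlockGL_eq_of_mem_torusU` (every `t ∈ torusU` is `hypBlockGL x θ`).
* §1 GENERIC (abstract `G`, `T ≤ G`, `B ≤ GL₂(ℂ)`, `e`, `φ`, `e′`, `he′`, weights `b`): **`iff_fst_mem_torusU_of_boost_clauses`** ⟹ the iff, the subgroup equation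
  `e′(T) = torusU × ⊤`, and the quotient homeomorphism with `Ψ ⟦g⟧ = ⟦(e′ g).1⟧`, `Ψ⁻¹ ⟦u⟧ = ⟦e′⁻¹ (u, 1)⟧` (★ `exists_quotient_homeomorph_of_map_eq_prod_top`).
* §2 LH3 DRESS **`hTAβ_package_semireg`**: `G := M′ = Z(gprimeTorus α S′ p)`, `T := (chartTorusG α (insert w₀ S′)).subgroupOf M′`, `b := formRe α w₀ ∘ τ₀`; hypotheses = the
  texts of ★ [5β]∕[7β] for the given `e` (so the consumer feeds the clauses of ONE `obtain`), `hφ` = ★ p850661's conclusion shape, `he′`.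
* §3 **`hTAβ_package_semireg_std`**: the same with `hφ` DISCHARGED by ★ p850661 from the (B-STD) binders `hsgn` (opposite signs of `re σ_{w₀}(α_{τ0})`, `re σ_{w₀}(α_{τ2})`) and
  `hval` (★ p850476 (ii) value formula of `φ`) — exactly the binders LH3-p02's ★ `exists_std_package` delivers.
HONEST LABEL: HC_CM is proved only modulo the 7 printed citations (2 remaining named inputs: hLiu418 = `stmt-HodgeConjecture-24832`, h413 = `stmt-HodgeConjecture-24833`) until
rung 0 closes; count-neutral bookkeeping under organ J of `stub_N9`.

## References
* [Rogawski1990] J. D. Rogawski, *Automorphic Representations of Unitary Groups in Three Variables*, Ann. of Math. Stud. 123 (1990), §3.6 p. 31, §8.2 p. 122.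
* [Shelstad1979] D. Shelstad, *Characters and inner forms of a quasi-split group over ℝ*, Compositio Math. 39 (1979), §4 pp. 22–25.
* [Folland1995] G. B. Folland, *A Course in Abstract Harmonic Analysis* (1995), §2.6.
* [PlatonovRapinchuk1994] V. Platonov, A. Rapinchuk, *Algebraic Groups and Number Theory* (1994), §2.3.
-/

set_option autoImplicit false

noncomputable section

open NumberField NumberField.InfinitePlace Matrix Complex Topology
open Literature.NumberTheory.Rogawski1990 Literature.LinearAlgebra.Matrix Literature.MeasureTheory.Group
open scoped MatrixGroups Matrix ComplexConjugate Classical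

namespace Literature.NumberTheory.Automorphic.UnitaryGroup

/-! ## §1 Generic: boost clauses + standardisation ⟹ the torus reads as `torusU` -/

section Generic

variable {G : Type*} [Group G] [TopologicalSpace G] {K : Type*} [Group K] [TopologicalSpace K] [ContinuousMul K]
  {B : Subgroup (GL (Fin 2) ℂ)} {J : Matrix (Fin 2) (Fin 2) ℂ} (hJ : J = (StdForm.antidiagonal 2).over ℂ)

include hJ in
/-- **Boost clauses + standardisation ⟹ `g ∈ T ↔ (e′ g).1 ∈ torusU`, `e′(T) = torusU × ⊤`, and `G ⧸ T ≃ₜ U(J) ⧸ torusU`.**  Hypotheses: `h7` (membership in `T` ⟺ the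
`B`-component of `e g` is a boost block), `hex` (every boost block occurs in `B`), `hφ` (the standardisation sends boost blocks to `hypBlockGL`), `he′` (`e′ = (φ × id) ∘ e`).
[cite: Rogawski1990, §3.6 p. 31; §8.2 p. 122] [cite: Shelstad1979, §4 pp. 22–25] [cite: Folland1995, §2.6] -/
theorem iff_fst_mem_torusU_of_boost_clauses (T : Subgroup G) (e : G ≃ₜ* ↥B × K)
    (φ : ↥B ≃ₜ* ↥(unitaryGroupOfForm (starRingEnd ℂ) J)) (e' : G ≃ₜ* ↥(unitaryGroupOfForm (starRingEnd ℂ) J) × K)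
    (he' : ∀ g, e' g = (φ (e g).1, (e g).2)) (b : Fin 3 → ℝ)
    (h7 : ∀ g : G, g ∈ T ↔ ∃ x θ : ℝ, (((e g).1 : GL (Fin 2) ℂ) : Matrix (Fin 2) (Fin 2) ℂ) = (boostStd b ![x, 0, θ]).submatrix ![0, 2] ![0, 2])
    (hex : ∀ x θ : ℝ, ∃ h : ↥B, ((h : GL (Fin 2) ℂ) : Matrix (Fin 2) (Fin 2) ℂ) = (boostStd b ![x, 0, θ]).submatrix ![0, 2] ![0, 2])
    (hφ : ∀ (h : ↥B) (c : Fin 3 → ℝ), ((h : GL (Fin 2) ℂ) : Matrix (Fin 2) (Fin 2) ℂ) = (boostStd b c).submatrix ![0, 2] ![0, 2] →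
      φ h = ⟨hypBlockGL (c 0) (c 2), hypBlockGL_mem_of_eq_over hJ (c 0) (c 2)⟩) :
    (∀ g : G, g ∈ T ↔ (e' g).1 ∈ torusU (starRingEnd ℂ) J) ∧
      Subgroup.map (e' : G →* ↥(unitaryGroupOfForm (starRingEnd ℂ) J) × K) T = (torusU (starRingEnd ℂ) J).prod ⊤ ∧
      ∃ Ψ : G ⧸ T ≃ₜ ↥(unitaryGroupOfForm (starRingEnd ℂ) J) ⧸ torusU (starRingEnd ℂ) J,
        (∀ g : G, Ψ (QuotientGroup.mk g) = QuotientGroup.mk (e' g).1) ∧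
        (∀ u : ↥(unitaryGroupOfForm (starRingEnd ℂ) J), Ψ.symm (QuotientGroup.mk u) = QuotientGroup.mk (e'.symm (u, 1))) := by
  -- the iff
  have hiff : ∀ g : G, g ∈ T ↔ (e' g).1 ∈ torusU (starRingEnd ℂ) J := by
    intro g
    rw [he']
    constructor
    · intro hg
      obtain ⟨x, θ, hxθ⟩ := (h7 g).1 hg
      have hφg := hφ (e g).1 ![x, 0, θ] hxθ
      show φ (e g).1 ∈ torusU (starRingEnd ℂ) J
      rw [hφg]
      exact hypBlockGL_mem_torusU hJ _ _
    · intro hg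
      change φ (e g).1 ∈ torusU (starRingEnd ℂ) J at hg
      obtain ⟨x, θ, hxθ⟩ := exists_hypBlockGL_eq_of_mem_torusU hJ _ hg
      obtain ⟨h, hh⟩ := hex x θ
      have hφh := hφ h ![x, 0, θ] hh
      have heq : φ h = φ (e g).1 := by
        apply Subtype.ext
        rw [hφh, hxθ]
        rfl
      have hh' : (e g).1 = h := (φ.injective heq).symm
      exact (h7 g).2 ⟨x, θ, by rw [hh']; exact hh⟩
  -- the subgroup equation
  have hmap : Subgroup.map (e' : G →* ↥(unitaryGroupOfForm (starRingEnd ℂ) J) × K) T = (torusU (starRingEnd ℂ) J).prod ⊤ := by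
    ext q
    simp only [Subgroup.mem_map, Subgroup.mem_prod, Subgroup.mem_top, and_true, MonoidHom.coe_coe]
    constructor
    · rintro ⟨g, hg, rfl⟩
      exact (hiff g).1 hg
    · intro hq
      refine ⟨e'.symm q, (hiff _).2 ?_, e'.apply_symm_apply q⟩
      rw [e'.apply_symm_apply]
      exact hq
  obtain ⟨Ψ, hΨ, hΨsymm⟩ := exists_quotient_homeomorph_of_map_eq_prod_top T (torusU (starRingEnd ℂ) J) e' hmap
  exact ⟨hiff, hmap, Ψ, hΨ, hΨsymm⟩

end Generic

/-! ## §2 The LH3 dress: the binders `hTAβ`, `Ψβ`, `hΨβ` of the (G′-CANCEL) head -/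

section Dress

variable (L : Type) [Field L] [NumberField L] [IsCMField L] (α : Fin 3 → L)
  (S' : Finset {w : InfinitePlace L // IsComplex w}) (w₀ : {w : InfinitePlace L // IsComplex w})

/-- **(b2) «`hTAβ` + `Ψβ`∕`hΨβ`» IN BINDER FORM.**  Given the block decomposition `e : M′ ≃ₜ* B × K` with its Cayley-chart clauses [5β] (every split-chart point's block is the boost
block) and [7β] (`g ∈ T♯ ↔` boost block) — both from ONE `obtain` of ★ `exists_continuousMulEquiv_centralizer_gprimeTorus_semireg_cayley_torus` — and a standardisation
`φ : B ≃ₜ* U(J)` sending boost blocks to `hypBlockGL` (★ `std_eq_hypBlockGL_of_coe_eq_boost`), with `e′ = (φ × id) ∘ e`: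
**`g ∈ (chartTorusG α (insert w₀ S′)).subgroupOf M′ ↔ (e′ g).1 ∈ torusU`**, `e′(T♯) = torusU × ⊤`, and **`Ψβ : M′ ⧸ T♯ ≃ₜ U(J) ⧸ torusU`** with
`Ψβ ⟦g⟧ = ⟦(e′ g).1⟧`, **`Ψβ⁻¹ ⟦u⟧ = ⟦e′⁻¹ (u, 1)⟧`**. [cite: Rogawski1990, §3.6 p. 31; §8.2 p. 122] [cite: Shelstad1979, §4 pp. 22–25] -/
theorem hTAβ_package_semireg (hw₀ : w₀ ∉ S') (hsp : w₀ ∈ splitChartPlaces L α)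
    (p : {w : InfinitePlace L // IsComplex w} → Fin 3 → ℝ) (hp : p w₀ 0 = p w₀ 2)
    (K : Subgroup ↥(Subgroup.centralizer ({gprimeTorus L α S' p} : Set ↥(arch (↥(maximalRealSubfield L)) L (IsCMField.complexConj L) 3 (Matrix.diagonal α)))))
    (e : ↥(Subgroup.centralizer ({gprimeTorus L α S' p} : Set ↥(arch (↥(maximalRealSubfield L)) L (IsCMField.complexConj L) 3 (Matrix.diagonal α)))) ≃ₜ* ↥(unitaryGroupOfForm (starRingEnd ℂ) ((Matrix.diagonal ![α (lineOf (formSign L α w₀) 0), α (lineOf (formSign L α w₀) 2)]).map w₀.1.embedding)) × ↥K)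
    (h5β : ∀ c : {w : InfinitePlace L // IsComplex w} → Fin 3 → ℝ,
        ((((e ⟨gprimeTorus L α (insert w₀ S') c, gprimeTorus_insert_mem_centralizer L α hw₀ hsp hp c⟩).1 : ↥(unitaryGroupOfForm (starRingEnd ℂ) ((Matrix.diagonal ![α (lineOf (formSign L α w₀) 0), α (lineOf (formSign L α w₀) 2)]).map w₀.1.embedding))) :
            GL (Fin 2) ℂ) : Matrix (Fin 2) (Fin 2) ℂ) =
          (boostStd (formRe L α w₀ ∘ (lineOf (formSign L α w₀))) (c w₀)).submatrix ![0, 2] ![0, 2])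
    (h7β : ∀ g : ↥(Subgroup.centralizer ({gprimeTorus L α S' p} : Set ↥(arch (↥(maximalRealSubfield L)) L (IsCMField.complexConj L) 3 (Matrix.diagonal α)))),
        (g : ↥(arch (↥(maximalRealSubfield L)) L (IsCMField.complexConj L) 3 (Matrix.diagonal α))) ∈ chartTorusG L α (insert w₀ S') ↔
          ∃ x θ : ℝ, ((((e g).1 : ↥(unitaryGroupOfForm (starRingEnd ℂ) ((Matrix.diagonal ![α (lineOf (formSign L α w₀) 0), α (lineOf (formSign L α w₀) 2)]).map w₀.1.embedding))) : GL (Fin 2) ℂ) : Matrix (Fin 2) (Fin 2) ℂ) =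
            (boostStd (formRe L α w₀ ∘ (lineOf (formSign L α w₀))) ![x, 0, θ]).submatrix ![0, 2] ![0, 2])
    {J : Matrix (Fin 2) (Fin 2) ℂ} (hJ : J = (StdForm.antidiagonal 2).over ℂ)
    (φ : ↥(unitaryGroupOfForm (starRingEnd ℂ) ((Matrix.diagonal ![α (lineOf (formSign L α w₀) 0), α (lineOf (formSign L α w₀) 2)]).map w₀.1.embedding)) ≃ₜ* ↥(unitaryGroupOfForm (starRingEnd ℂ) J))
    (hφ : ∀ (h : ↥(unitaryGroupOfForm (starRingEnd ℂ) ((Matrix.diagonal ![α (lineOf (formSign L α w₀) 0), α (lineOf (formSign L α w₀) 2)]).map w₀.1.embedding))) (c : Fin 3 → ℝ),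
      ((h : GL (Fin 2) ℂ) : Matrix (Fin 2) (Fin 2) ℂ) = (boostStd (formRe L α w₀ ∘ (lineOf (formSign L α w₀))) c).submatrix ![0, 2] ![0, 2] →
        φ h = ⟨hypBlockGL (c 0) (c 2), hypBlockGL_mem_of_eq_over hJ (c 0) (c 2)⟩)
    (e' : ↥(Subgroup.centralizer ({gprimeTorus L α S' p} : Set ↥(arch (↥(maximalRealSubfield L)) L (IsCMField.complexConj L) 3 (Matrix.diagonal α)))) ≃ₜ* ↥(unitaryGroupOfForm (starRingEnd ℂ) J) × ↥K)
    (he' : ∀ g, e' g = (φ (e g).1, (e g).2)) :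
    (∀ g : ↥(Subgroup.centralizer ({gprimeTorus L α S' p} : Set ↥(arch (↥(maximalRealSubfield L)) L (IsCMField.complexConj L) 3 (Matrix.diagonal α)))),
        g ∈ (chartTorusG L α (insert w₀ S')).subgroupOf (Subgroup.centralizer ({gprimeTorus L α S' p} : Set ↥(arch (↥(maximalRealSubfield L)) L (IsCMField.complexConj L) 3 (Matrix.diagonal α)))) ↔ (e' g).1 ∈ torusU (starRingEnd ℂ) J) ∧
      Subgroup.map (e' : ↥(Subgroup.centralizer ({gprimeTorus L α S' p} : Set ↥(arch (↥(maximalRealSubfield L)) L (IsCMField.complexConj L) 3 (Matrix.diagonal α)))) →* ↥(unitaryGroupOfForm (starRingEnd ℂ) J) × ↥K)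
          ((chartTorusG L α (insert w₀ S')).subgroupOf (Subgroup.centralizer ({gprimeTorus L α S' p} : Set ↥(arch (↥(maximalRealSubfield L)) L (IsCMField.complexConj L) 3 (Matrix.diagonal α))))) = (torusU (starRingEnd ℂ) J).prod ⊤ ∧
      ∃ Ψβ : ↥(Subgroup.centralizer ({gprimeTorus L α S' p} : Set ↥(arch (↥(maximalRealSubfield L)) L (IsCMField.complexConj L) 3 (Matrix.diagonal α)))) ⧸ (chartTorusG L α (insert w₀ S')).subgroupOf (Subgroup.centralizer ({gprimeTorus L α S' p} : Set ↥(arch (↥(maximalRealSubfield L)) L (IsCMField.complexConj L) 3 (Matrix.diagonal α)))) ≃ₜ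
          ↥(unitaryGroupOfForm (starRingEnd ℂ) J) ⧸ torusU (starRingEnd ℂ) J,
        (∀ g : ↥(Subgroup.centralizer ({gprimeTorus L α S' p} : Set ↥(arch (↥(maximalRealSubfield L)) L (IsCMField.complexConj L) 3 (Matrix.diagonal α)))), Ψβ (QuotientGroup.mk g) = QuotientGroup.mk (e' g).1) ∧
        (∀ u : ↥(unitaryGroupOfForm (starRingEnd ℂ) J), Ψβ.symm (QuotientGroup.mk u) = QuotientGroup.mk (e'.symm (u, 1))) := by
  have h7 : ∀ g : ↥(Subgroup.centralizer ({gprimeTorus L α S' p} : Set ↥(arch (↥(maximalRealSubfield L)) L (IsCMField.complexConj L) 3 (Matrix.diagonal α)))),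
      g ∈ (chartTorusG L α (insert w₀ S')).subgroupOf (Subgroup.centralizer ({gprimeTorus L α S' p} : Set ↥(arch (↥(maximalRealSubfield L)) L (IsCMField.complexConj L) 3 (Matrix.diagonal α)))) ↔
        ∃ x θ : ℝ, ((((e g).1 : ↥(unitaryGroupOfForm (starRingEnd ℂ) ((Matrix.diagonal ![α (lineOf (formSign L α w₀) 0), α (lineOf (formSign L α w₀) 2)]).map w₀.1.embedding))) : GL (Fin 2) ℂ) : Matrix (Fin 2) (Fin 2) ℂ) =
          (boostStd (formRe L α w₀ ∘ (lineOf (formSign L α w₀))) ![x, 0, θ]).submatrix ![0, 2] ![0, 2] := fun g => by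
    rw [Subgroup.mem_subgroupOf]
    exact h7β g
  have hex : ∀ x θ : ℝ, ∃ h : ↥(unitaryGroupOfForm (starRingEnd ℂ) ((Matrix.diagonal ![α (lineOf (formSign L α w₀) 0), α (lineOf (formSign L α w₀) 2)]).map w₀.1.embedding)),
      ((h : GL (Fin 2) ℂ) : Matrix (Fin 2) (Fin 2) ℂ) = (boostStd (formRe L α w₀ ∘ (lineOf (formSign L α w₀))) ![x, 0, θ]).submatrix ![0, 2] ![0, 2] := by
    intro x θ
    refine ⟨(e ⟨gprimeTorus L α (insert w₀ S') (Function.update p w₀ ![x, 0, θ]),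
      gprimeTorus_insert_mem_centralizer L α hw₀ hsp hp _⟩).1, ?_⟩
    rw [h5β, Function.update_self]
  exact iff_fst_mem_torusU_of_boost_clauses hJ _ e φ e' he' _ h7 hex hφ

/-! ## §3 The same with `hφ` discharged by (B-STD) (iii) -/

/-- **(b2) FROM THE (B-STD) BINDERS.**  As `hTAβ_package_semireg`, but the block-reading hypothesis `hφ` is discharged by ★ `std_eq_hypBlockGL_of_coe_eq_boost` (p850661) from
`hsgn : re σ_{w₀}(α_{τ0}) · re σ_{w₀}(α_{τ2}) < 0` and the value formula `hval : φ h = (P·D)·h·(P·D)⁻¹` of ★ `ArchRankOneBlockStandardise` (p850476 (ii)) — so the consumer passes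
the binders of ONE `obtain` of ★ `exists_continuousMulEquiv_centralizer_gprimeTorus_semireg_cayley_torus` ([5β], [7β]) and ONE of ★ `exists_std_package` (`φ`, `hval`, `e′`, `he′`):
**`g ∈ T♯ ↔ (e′ g).1 ∈ torusU`**, `e′(T♯) = torusU × ⊤`, **`Ψβ`** with `Ψβ ⟦g⟧ = ⟦(e′ g).1⟧`, `Ψβ⁻¹ ⟦u⟧ = ⟦e′⁻¹ (u, 1)⟧`.
[cite: Rogawski1990, §3.6 p. 31; §8.2 p. 122] [cite: Shelstad1979, §4 pp. 22–25] [cite: PlatonovRapinchuk1994, §2.3] -/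
theorem hTAβ_package_semireg_std (hw₀ : w₀ ∉ S') (hsp : w₀ ∈ splitChartPlaces L α)
    (p : {w : InfinitePlace L // IsComplex w} → Fin 3 → ℝ) (hp : p w₀ 0 = p w₀ 2)
    (K : Subgroup ↥(Subgroup.centralizer ({gprimeTorus L α S' p} : Set ↥(arch (↥(maximalRealSubfield L)) L (IsCMField.complexConj L) 3 (Matrix.diagonal α)))))
    (e : ↥(Subgroup.centralizer ({gprimeTorus L α S' p} : Set ↥(arch (↥(maximalRealSubfield L)) L (IsCMField.complexConj L) 3 (Matrix.diagonal α)))) ≃ₜ* ↥(unitaryGroupOfForm (starRingEnd ℂ) ((Matrix.diagonal ![α (lineOf (formSign L α w₀) 0), α (lineOf (formSign L α w₀) 2)]).map w₀.1.embedding)) × ↥K)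
    (h5β : ∀ c : {w : InfinitePlace L // IsComplex w} → Fin 3 → ℝ,
        ((((e ⟨gprimeTorus L α (insert w₀ S') c, gprimeTorus_insert_mem_centralizer L α hw₀ hsp hp c⟩).1 : ↥(unitaryGroupOfForm (starRingEnd ℂ) ((Matrix.diagonal ![α (lineOf (formSign L α w₀) 0), α (lineOf (formSign L α w₀) 2)]).map w₀.1.embedding))) :
            GL (Fin 2) ℂ) : Matrix (Fin 2) (Fin 2) ℂ) =
          (boostStd (formRe L α w₀ ∘ (lineOf (formSign L α w₀))) (c w₀)).submatrix ![0, 2] ![0, 2])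
    (h7β : ∀ g : ↥(Subgroup.centralizer ({gprimeTorus L α S' p} : Set ↥(arch (↥(maximalRealSubfield L)) L (IsCMField.complexConj L) 3 (Matrix.diagonal α)))),
        (g : ↥(arch (↥(maximalRealSubfield L)) L (IsCMField.complexConj L) 3 (Matrix.diagonal α))) ∈ chartTorusG L α (insert w₀ S') ↔
          ∃ x θ : ℝ, ((((e g).1 : ↥(unitaryGroupOfForm (starRingEnd ℂ) ((Matrix.diagonal ![α (lineOf (formSign L α w₀) 0), α (lineOf (formSign L α w₀) 2)]).map w₀.1.embedding))) : GL (Fin 2) ℂ) : Matrix (Fin 2) (Fin 2) ℂ) =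
            (boostStd (formRe L α w₀ ∘ (lineOf (formSign L α w₀))) ![x, 0, θ]).submatrix ![0, 2] ![0, 2])
    {J : Matrix (Fin 2) (Fin 2) ℂ} (hJ : J = (StdForm.antidiagonal 2).over ℂ)
    (hsgn : (w₀.1.embedding (α (lineOf (formSign L α w₀) 0))).re * (w₀.1.embedding (α (lineOf (formSign L α w₀) 2))).re < 0)
    (φ : ↥(unitaryGroupOfForm (starRingEnd ℂ) ((Matrix.diagonal ![α (lineOf (formSign L α w₀) 0), α (lineOf (formSign L α w₀) 2)]).map w₀.1.embedding)) ≃ₜ* ↥(unitaryGroupOfForm (starRingEnd ℂ) J))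
    (hval : ∀ h : ↥(unitaryGroupOfForm (starRingEnd ℂ) ((Matrix.diagonal ![α (lineOf (formSign L α w₀) 0), α (lineOf (formSign L α w₀) 2)]).map w₀.1.embedding)),
      ((φ h : ↥(unitaryGroupOfForm (starRingEnd ℂ) J)) : GL (Fin 2) ℂ) =
        Matrix.GeneralLinearGroup.mkOfDetNeZero !![(1 : ℂ), 1; 1, -1] det_cayleyTwo_ne_zero *
          Matrix.GeneralLinearGroup.mkOfDetNeZero
            (Matrix.diagonal ![((Real.sqrt (|(w₀.1.embedding (![α (lineOf (formSign L α w₀) 0), α (lineOf (formSign L α w₀) 2)] 0)).re| / 2) : ℝ) : ℂ),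
              ((Real.sqrt (|(w₀.1.embedding (![α (lineOf (formSign L α w₀) 0), α (lineOf (formSign L α w₀) 2)] 1)).re| / 2) : ℝ) : ℂ)])
            (det_blockScale_ne_zero _ _ hsgn) * (h : GL (Fin 2) ℂ) *
        (Matrix.GeneralLinearGroup.mkOfDetNeZero !![(1 : ℂ), 1; 1, -1] det_cayleyTwo_ne_zero *
          Matrix.GeneralLinearGroup.mkOfDetNeZero
            (Matrix.diagonal ![((Real.sqrt (|(w₀.1.embedding (![α (lineOf (formSign L α w₀) 0), α (lineOf (formSign L α w₀) 2)] 0)).re| / 2) : ℝ) : ℂ),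
              ((Real.sqrt (|(w₀.1.embedding (![α (lineOf (formSign L α w₀) 0), α (lineOf (formSign L α w₀) 2)] 1)).re| / 2) : ℝ) : ℂ)])
            (det_blockScale_ne_zero _ _ hsgn))⁻¹)
    (e' : ↥(Subgroup.centralizer ({gprimeTorus L α S' p} : Set ↥(arch (↥(maximalRealSubfield L)) L (IsCMField.complexConj L) 3 (Matrix.diagonal α)))) ≃ₜ* ↥(unitaryGroupOfForm (starRingEnd ℂ) J) × ↥K)
    (he' : ∀ g, e' g = (φ (e g).1, (e g).2)) :
    (∀ g : ↥(Subgroup.centralizer ({gprimeTorus L α S' p} : Set ↥(arch (↥(maximalRealSubfield L)) L (IsCMField.complexConj L) 3 (Matrix.diagonal α)))),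
        g ∈ (chartTorusG L α (insert w₀ S')).subgroupOf (Subgroup.centralizer ({gprimeTorus L α S' p} : Set ↥(arch (↥(maximalRealSubfield L)) L (IsCMField.complexConj L) 3 (Matrix.diagonal α)))) ↔ (e' g).1 ∈ torusU (starRingEnd ℂ) J) ∧
      Subgroup.map (e' : ↥(Subgroup.centralizer ({gprimeTorus L α S' p} : Set ↥(arch (↥(maximalRealSubfield L)) L (IsCMField.complexConj L) 3 (Matrix.diagonal α)))) →* ↥(unitaryGroupOfForm (starRingEnd ℂ) J) × ↥K)
          ((chartTorusG L α (insert w₀ S')).subgroupOf (Subgroup.centralizer ({gprimeTorus L α S' p} : Set ↥(arch (↥(maximalRealSubfield L)) L (IsCMField.complexConj L) 3 (Matrix.diagonal α))))) = (torusU (starRingEnd ℂ) J).prod ⊤ ∧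
      ∃ Ψβ : ↥(Subgroup.centralizer ({gprimeTorus L α S' p} : Set ↥(arch (↥(maximalRealSubfield L)) L (IsCMField.complexConj L) 3 (Matrix.diagonal α)))) ⧸ (chartTorusG L α (insert w₀ S')).subgroupOf (Subgroup.centralizer ({gprimeTorus L α S' p} : Set ↥(arch (↥(maximalRealSubfield L)) L (IsCMField.complexConj L) 3 (Matrix.diagonal α)))) ≃ₜ
          ↥(unitaryGroupOfForm (starRingEnd ℂ) J) ⧸ torusU (starRingEnd ℂ) J,
        (∀ g : ↥(Subgroup.centralizer ({gprimeTorus L α S' p} : Set ↥(arch (↥(maximalRealSubfield L)) L (IsCMField.complexConj L) 3 (Matrix.diagonal α)))), Ψβ (QuotientGroup.mk g) = QuotientGroup.mk (e' g).1) ∧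
        (∀ u : ↥(unitaryGroupOfForm (starRingEnd ℂ) J), Ψβ.symm (QuotientGroup.mk u) = QuotientGroup.mk (e'.symm (u, 1))) :=
  hTAβ_package_semireg L α S' w₀ hw₀ hsp p hp K e h5β h7β hJ φ
    (fun h c hh => std_eq_hypBlockGL_of_coe_eq_boost w₀.1.embedding ![α (lineOf (formSign L α w₀) 0), α (lineOf (formSign L α w₀) 2)] hJ hsgn φ hval
      (formRe L α w₀ ∘ (lineOf (formSign L α w₀))) rfl rfl c h hh) e' he'

end Dress

end Literature.NumberTheory.Automorphic.UnitaryGroup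

end
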